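import Summits.Ventures.PercRepro.C026HubA

/-!
# C-026 on hub graphs, II: the three cases of `Bot₃` and the separation lemmas (p5, gen 8)

On a simple hub graph with distinct marks, a `bot` configuration `ω` is in `Bot₃` (`a ~ b` in the
cut tree `δ(ω)`) iff **Case 1** (a `c`-hub with edges to `a` and `b`) or (**`a ~ c`**: an
`ac`-edge or an `a`-hub with a `c`-edge) and (**`c ~ b`**: a `bc`-edge or an isolated hub with
`c`- and `b`-edges) — `IsBot.conn_cutSwap_iff`, `bot3_iff`, by the closed-boundary argument on
the open edges of `δ(ω)` (`IsBot.cutSwap_open_cases`).  The two separation lemmas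
(`IsBot.not_conn_ab_of_ac_side`, `IsBot.not_conn_ab_of_closed_side`) show `a ≁ b` after opening
edges on one side of a `bot` configuration; they place the images of the injections of
`C026HubC.lean` in the cells `ac|b` / `bc|a`.
-/

namespace PercRepro

open Finset

namespace MultiGraph

variable {V E : Type*} {G : MultiGraph V E}

section Bot

variable {a b c : V} {ω : Config E}

/-- A link transports an equivalence at its two ends to the endpoints of the edge. -/
theorem Link.boundary_iff {e : E} {x y : V} (hl : G.Link e x y) {P : V → Prop}
    (h : P x ↔ P y) : (P (G.fst e) ↔ P (G.snd e)) := by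
  rcases hl with ⟨h1, h2⟩ | ⟨h1, h2⟩
  · rw [h1, h2]
    exact h
  · rw [h1, h2]
    exact h.symm

/-- **The open edges of `δ(ω)`** on a simple hub graph in `bot`. -/
theorem IsBot.cutSwap_open_cases (hG : G.IsHubGraph a b c) (hs : G.IsSimple) (hab : a ≠ b)
    (hac : a ≠ c) (hbc : b ≠ c) (hbot : G.IsBot ω a b c) {e : E}
    (he : G.cutSwap a b c ω e = true) :
    G.Link e a c ∨ G.Link e b c ∨
      (∃ h, IsHubV a b c h ∧ G.Link e h a ∧ (G.OpenTo ω h a ∨ G.OpenTo ω h c)) ∨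
      (∃ h, IsHubV a b c h ∧ G.Link e h b ∧
        (G.OpenTo ω h c ∨ (¬ G.OpenTo ω h a ∧ ¬ G.OpenTo ω h b ∧ ¬ G.OpenTo ω h c))) ∨
      (∃ h, IsHubV a b c h ∧ G.Link e h c ∧ ¬ G.OpenTo ω h c) := by
  rcases hG.edge_cases hs e with hl | hl | hl | ⟨h, hh, hl | hl | hl⟩
  · rw [hbot.cutSwap_link_ab hG hs hab hac hbc hl] at he
    exact Bool.noConfusion he
  · exact Or.inl hl
  · exact Or.inr (Or.inl hl)
  · exact Or.inr (Or.inr (Or.inl ⟨h, hh, hl, (hbot.cutSwap_link_ha hG hs hab hac hh hl).1 he⟩))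
  · exact Or.inr (Or.inr (Or.inr (Or.inl ⟨h, hh, hl,
      (hbot.cutSwap_link_hb hG hs hab hbc hh hl).1 he⟩)))
  · exact Or.inr (Or.inr (Or.inr (Or.inr ⟨h, hh, hl, (cutSwap_link_hc hs hl).1 he⟩)))

end Bot

/-! ### The three cases of `Bot₃` on a hub graph -/

variable (G)

/-- The hub `h` has no open edge (to any mark) in `ω`. -/
def NoOpen (ω : Config E) (a b c h : V) : Prop :=
  ¬ G.OpenTo ω h a ∧ ¬ G.OpenTo ω h b ∧ ¬ G.OpenTo ω h c

/-- **Case 1**: a `c`-hub (open edge to `c`) with edges to both `a` and `b`. -/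
def Case1 (ω : Config E) (a b c : V) : Prop :=
  ∃ h, IsHubV a b c h ∧ G.OpenTo ω h c ∧ G.HasEdge h a ∧ G.HasEdge h b

/-- **`a ~ c` in `δ(ω)`**: an `ac`-edge, or an `a`-hub with an edge to `c`. -/
def AtoC (ω : Config E) (a b c : V) : Prop :=
  G.HasEdge a c ∨ ∃ h, IsHubV a b c h ∧ G.OpenTo ω h a ∧ G.HasEdge h c

/-- **An isolated hub with edges to `c` and to `b`** (Case 2 without a `bc`-edge). -/
def Case2Iso (ω : Config E) (a b c : V) : Prop :=
  ∃ h, IsHubV a b c h ∧ G.NoOpen ω a b c h ∧ G.HasEdge h c ∧ G.HasEdge h b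

/-- **`c ~ b` in `δ(ω)`**: a `bc`-edge, or an isolated hub with edges to `c` and to `b`. -/
def CtoB (ω : Config E) (a b c : V) : Prop := G.HasEdge b c ∨ G.Case2Iso ω a b c

variable {G}

section Cases

variable {a b c : V} {ω : Config E}

/-- **`a ~ b` in `δ(ω)` on a simple hub graph in `bot`**: Case 1, or `a ~ c` and `c ~ b`. -/
theorem IsBot.conn_cutSwap_iff (hG : G.IsHubGraph a b c) (hs : G.IsSimple) (hab : a ≠ b)
    (hac : a ≠ c) (hbc : b ≠ c) (hbot : G.IsBot ω a b c) :
    G.Conn (G.cutSwap a b c ω) a b ↔ G.Case1 ω a b c ∨ (G.AtoC ω a b c ∧ G.CtoB ω a b c) := by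
  constructor
  · intro hconn
    by_cases h1 : G.Case1 ω a b c
    · exact Or.inl h1
    refine Or.inr ⟨?_, ?_⟩
    · by_contra hA
      -- the closed boundary `X = {a} ∪ {a-side hubs}` of `δ(ω)` separates `a` from `b`
      have hX : ∀ e, G.cutSwap a b c ω e = true →
          ((G.fst e = a ∨ (IsHubV a b c (G.fst e) ∧ G.HasEdge (G.fst e) a ∧
            (G.OpenTo ω (G.fst e) a ∨ G.OpenTo ω (G.fst e) c))) ↔
          (G.snd e = a ∨ (IsHubV a b c (G.snd e) ∧ G.HasEdge (G.snd e) a ∧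
            (G.OpenTo ω (G.snd e) a ∨ G.OpenTo ω (G.snd e) c)))) := by
        intro e he
        rcases hbot.cutSwap_open_cases hG hs hab hac hbc he with hl | hl | ⟨h, hh, hl, hor⟩ |
          ⟨h, hh, hl, hor⟩ | ⟨h, hh, hl, hno⟩
        · exact absurd (Or.inl ⟨e, hl⟩) hA
        · refine hl.boundary_iff (P := fun x => x = a ∨ (IsHubV a b c x ∧ G.HasEdge x a ∧ (G.OpenTo ω x a ∨ G.OpenTo ω x c))) ?_
          constructor
          · rintro (h' | ⟨h', -⟩)
            · exact absurd h'.symm hab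
            · exact absurd rfl h'.2.1
          · rintro (h' | ⟨h', -⟩)
            · exact absurd h'.symm hac
            · exact absurd rfl h'.2.2
        · refine hl.boundary_iff (P := fun x => x = a ∨ (IsHubV a b c x ∧ G.HasEdge x a ∧ (G.OpenTo ω x a ∨ G.OpenTo ω x c))) ?_
          exact ⟨fun _ => Or.inl rfl, fun _ => Or.inr ⟨hh, ⟨e, hl⟩, hor⟩⟩
        · refine hl.boundary_iff (P := fun x => x = a ∨ (IsHubV a b c x ∧ G.HasEdge x a ∧ (G.OpenTo ω x a ∨ G.OpenTo ω x c))) ?_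
          constructor
          · rintro (h' | ⟨-, hea, hor'⟩)
            · exact absurd h' hh.1
            · rcases hor with hc | hno
              · exact absurd ⟨h, hh, hc, hea, ⟨e, hl⟩⟩ h1
              · rcases hor' with h' | h'
                · exact absurd h' hno.1
                · exact absurd h' hno.2.2
          · rintro (h' | ⟨h', -⟩)
            · exact absurd h'.symm hab
            · exact absurd rfl h'.2.1
        · refine hl.boundary_iff (P := fun x => x = a ∨ (IsHubV a b c x ∧ G.HasEdge x a ∧ (G.OpenTo ω x a ∨ G.OpenTo ω x c))) ?_
          constructor
          · rintro (h' | ⟨-, hea, hor'⟩)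
            · exact absurd h' hh.1
            · rcases hor' with h' | h'
              · exact absurd (Or.inr ⟨h, hh, h', ⟨e, hl⟩⟩) hA
              · exact absurd h' hno
          · rintro (h' | ⟨h', -⟩)
            · exact absurd h'.symm hac
            · exact absurd rfl h'.2.2
      have hb := G.mem_of_conn_of_closed_boundary (X := {x | x = a ∨ (IsHubV a b c x ∧
        G.HasEdge x a ∧ (G.OpenTo ω x a ∨ G.OpenTo ω x c))}) hX (Or.inl rfl) hconn
      rcases hb with h' | ⟨h', -⟩
      · exact hab h'.symm
      · exact h'.2.1 rfl
    · by_contra hB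
      -- the closed boundary `Y = {b} ∪ {b-side hubs}` of `δ(ω)` separates `b` from `a`
      have hY : ∀ e, G.cutSwap a b c ω e = true →
          ((G.fst e = b ∨ (IsHubV a b c (G.fst e) ∧ G.HasEdge (G.fst e) b ∧
            (G.OpenTo ω (G.fst e) c ∨ G.NoOpen ω a b c (G.fst e)))) ↔
          (G.snd e = b ∨ (IsHubV a b c (G.snd e) ∧ G.HasEdge (G.snd e) b ∧
            (G.OpenTo ω (G.snd e) c ∨ G.NoOpen ω a b c (G.snd e))))) := by
        intro e he
        rcases hbot.cutSwap_open_cases hG hs hab hac hbc he with hl | hl | ⟨h, hh, hl, hor⟩ |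
          ⟨h, hh, hl, hor⟩ | ⟨h, hh, hl, hno⟩
        · refine hl.boundary_iff (P := fun x => x = b ∨ (IsHubV a b c x ∧ G.HasEdge x b ∧ (G.OpenTo ω x c ∨ G.NoOpen ω a b c x))) ?_
          constructor
          · rintro (h' | ⟨h', -⟩)
            · exact absurd h' hab
            · exact absurd rfl h'.1
          · rintro (h' | ⟨h', -⟩)
            · exact absurd h'.symm hbc
            · exact absurd rfl h'.2.2
        · exact absurd (Or.inl ⟨e, hl⟩) hB
        · refine hl.boundary_iff (P := fun x => x = b ∨ (IsHubV a b c x ∧ G.HasEdge x b ∧ (G.OpenTo ω x c ∨ G.NoOpen ω a b c x))) ?_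
          constructor
          · rintro (h' | ⟨-, heb, hor'⟩)
            · exact absurd h' hh.2.1
            · rcases hor with ha | hc
              · rcases hor' with h' | h'
                · exact (hbot.openTo_unique (Or.inl rfl) (Or.inr (Or.inr rfl)) hac ha h').elim
                · exact absurd ha h'.1
              · rcases hor' with h' | h'
                · exact absurd ⟨h, hh, hc, ⟨e, hl⟩, heb⟩ h1
                · exact absurd hc h'.2.2
          · rintro (h' | ⟨h', -⟩)
            · exact absurd h' hab
            · exact absurd rfl h'.1
        · refine hl.boundary_iff (P := fun x => x = b ∨ (IsHubV a b c x ∧ G.HasEdge x b ∧ (G.OpenTo ω x c ∨ G.NoOpen ω a b c x))) ?_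
          exact ⟨fun _ => Or.inl rfl, fun _ => Or.inr ⟨hh, ⟨e, hl⟩, hor⟩⟩
        · refine hl.boundary_iff (P := fun x => x = b ∨ (IsHubV a b c x ∧ G.HasEdge x b ∧ (G.OpenTo ω x c ∨ G.NoOpen ω a b c x))) ?_
          constructor
          · rintro (h' | ⟨-, heb, hor'⟩)
            · exact absurd h' hh.2.1
            · rcases hor' with h' | h'
              · exact absurd h' hno
              · exact absurd (Or.inr ⟨h, hh, h', ⟨e, hl⟩, heb⟩) hB
          · rintro (h' | ⟨h', -⟩)
            · exact absurd h'.symm hbc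
            · exact absurd rfl h'.2.2
      have ha := G.mem_of_conn_of_closed_boundary (X := {x | x = b ∨ (IsHubV a b c x ∧
        G.HasEdge x b ∧ (G.OpenTo ω x c ∨ G.NoOpen ω a b c x))}) hY (Or.inl rfl) hconn.symm
      rcases ha with h' | ⟨h', -⟩
      · exact hab h'
      · exact h'.1 rfl
  · rintro (⟨h, hh, hc, ⟨ea, hla⟩, ⟨eb, hlb⟩⟩ | ⟨hA, hB⟩)
    · have h1 : G.cutSwap a b c ω ea = true :=
        (hbot.cutSwap_link_ha hG hs hab hac hh hla).2 (Or.inr hc)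
      have h2 : G.cutSwap a b c ω eb = true :=
        (hbot.cutSwap_link_hb hG hs hab hbc hh hlb).2 (Or.inl hc)
      exact (hla.conn h1).symm.trans (hlb.conn h2)
    · have hAC : G.Conn (G.cutSwap a b c ω) a c := by
        rcases hA with ⟨e, hl⟩ | ⟨h, hh, ha, ⟨ec, hlc⟩⟩
        · exact hl.conn (hbot.cutSwap_link_ac hac hl)
        · obtain ⟨ea, hea, hla⟩ := ha
          have h1 : G.cutSwap a b c ω ea = true :=
            (hbot.cutSwap_link_ha hG hs hab hac hh hla).2 (Or.inl ⟨ea, hea, hla⟩)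
          have h2 : G.cutSwap a b c ω ec = true :=
            (cutSwap_link_hc hs hlc).2 fun hc =>
              hbot.openTo_unique (Or.inl rfl) (Or.inr (Or.inr rfl)) hac ⟨ea, hea, hla⟩ hc
          exact (hla.conn h1).symm.trans (hlc.conn h2)
      have hCB : G.Conn (G.cutSwap a b c ω) c b := by
        rcases hB with ⟨e, hl⟩ | ⟨h, hh, hno, ⟨ec, hlc⟩, ⟨eb, hlb⟩⟩
        · exact (hl.conn (hbot.cutSwap_link_bc hbc hl)).symm
        · have h1 : G.cutSwap a b c ω ec = true := (cutSwap_link_hc hs hlc).2 hno.2.2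
          have h2 : G.cutSwap a b c ω eb = true :=
            (hbot.cutSwap_link_hb hG hs hab hbc hh hlb).2 (Or.inr hno)
          exact (hlc.conn h1).symm.trans (hlb.conn h2)
      exact hAC.trans hCB

/-- **`Bot₃` on a simple hub graph**: `bot` and (Case 1 or `a ~ c ~ b`). -/
theorem bot3_iff (hG : G.IsHubGraph a b c) (hs : G.IsSimple) (hab : a ≠ b) (hac : a ≠ c)
    (hbc : b ≠ c) : G.Bot3 ω a b c ↔
      G.IsBot ω a b c ∧ (G.Case1 ω a b c ∨ (G.AtoC ω a b c ∧ G.CtoB ω a b c)) := by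
  constructor
  · rintro ⟨hbot, hconn⟩
    exact ⟨hbot, (hbot.conn_cutSwap_iff hG hs hab hac hbc).1 hconn⟩
  · rintro ⟨hbot, h⟩
    exact ⟨hbot, (hbot.conn_cutSwap_iff hG hs hab hac hbc).2 h⟩

end Cases

/-! ### The injections -/

section Injection

open Classical

variable {a b c : V}

/-- The two endpoints of an edge are determined up to order. -/
theorem Link.ends_eq {e : E} {x y x' y' : V} (h : G.Link e x y) (h' : G.Link e x' y') :
    (x' = x ∧ y' = y) ∨ (x' = y ∧ y' = x) := by
  rcases h with ⟨h1, h2⟩ | ⟨h1, h2⟩ <;> rcases h' with ⟨h1', h2'⟩ | ⟨h1', h2'⟩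
  · exact Or.inl ⟨h1'.symm.trans h1, h2'.symm.trans h2⟩
  · exact Or.inr ⟨h2'.symm.trans h2, h1'.symm.trans h1⟩
  · exact Or.inr ⟨h1'.symm.trans h1, h2'.symm.trans h2⟩
  · exact Or.inl ⟨h2'.symm.trans h2, h1'.symm.trans h1⟩

/-- No vertex has an open edge to itself in a simple graph. -/
theorem not_openTo_self (hs : G.IsSimple) (ω : Config E) (x : V) : ¬ G.OpenTo ω x x := by
  rintro ⟨g, -, hlg⟩
  exact hs.1 g (by rcases hlg with ⟨h1, h2⟩ | ⟨h1, h2⟩ <;> rw [h1, h2])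

/-- **Separation after opening edges on the `a`–`c` side** (Case 1): if `ω` is `bot` and every
edge open in `ω'` but closed in `ω` joins two vertices of
`X = {a, c} ∪ {x | x has an open ω-edge to a or to c}` (or none), then `a ≁ b` in `ω'`. -/
theorem IsBot.not_conn_ab_of_ac_side (hG : G.IsHubGraph a b c) (hs : G.IsSimple)
    (hab : a ≠ b) (hac : a ≠ c) (hbc : b ≠ c) {ω ω' : Config E} (hbot : G.IsBot ω a b c)
    (hnew : ∀ e, ω' e = true → ω e = false →
      ((G.fst e = a ∨ G.fst e = c ∨ G.OpenTo ω (G.fst e) a ∨ G.OpenTo ω (G.fst e) c) ↔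
        (G.snd e = a ∨ G.snd e = c ∨ G.OpenTo ω (G.snd e) a ∨ G.OpenTo ω (G.snd e) c))) :
    ¬ G.Conn ω' a b := by
  intro hconn
  have hX : ∀ e, ω' e = true →
      ((G.fst e = a ∨ G.fst e = c ∨ G.OpenTo ω (G.fst e) a ∨ G.OpenTo ω (G.fst e) c) ↔
        (G.snd e = a ∨ G.snd e = c ∨ G.OpenTo ω (G.snd e) a ∨ G.OpenTo ω (G.snd e) c)) := by
    intro e he
    cases hωe : ω e
    · exact hnew e he hωe
    · rcases hG.edge_cases hs e with hl | hl | hl | ⟨h, hh, hl | hl | hl⟩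
      · exact absurd ⟨e, hωe, hl⟩ (hbot.not_openTo_marks (Or.inl rfl) (Or.inr (Or.inl rfl)) hab)
      · exact absurd ⟨e, hωe, hl⟩ (hbot.not_openTo_marks (Or.inl rfl) (Or.inr (Or.inr rfl)) hac)
      · exact absurd ⟨e, hωe, hl⟩
          (hbot.not_openTo_marks (Or.inr (Or.inl rfl)) (Or.inr (Or.inr rfl)) hbc)
      · exact hl.boundary_iff (P := fun x => x = a ∨ x = c ∨ G.OpenTo ω x a ∨ G.OpenTo ω x c) ⟨fun _ => Or.inl rfl, fun _ => Or.inr (Or.inr (Or.inl ⟨e, hωe, hl⟩))⟩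
      · refine hl.boundary_iff (P := fun x => x = a ∨ x = c ∨ G.OpenTo ω x a ∨ G.OpenTo ω x c) ?_
        constructor
        · rintro (h' | h' | h' | h')
          · exact absurd h' hh.1
          · exact absurd h' hh.2.2
          · exact (hbot.openTo_unique (Or.inl rfl) (Or.inr (Or.inl rfl)) hab h' ⟨e, hωe, hl⟩).elim
          · exact (hbot.openTo_unique (Or.inr (Or.inr rfl)) (Or.inr (Or.inl rfl)) hbc.symm h'
              ⟨e, hωe, hl⟩).elim
        · rintro (h' | h' | h' | h')
          · exact absurd h'.symm hab
          · exact absurd h' hbc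
          · exact absurd h' (hbot.not_openTo_marks (Or.inr (Or.inl rfl)) (Or.inl rfl) hab.symm)
          · exact absurd h' (hbot.not_openTo_marks (Or.inr (Or.inl rfl)) (Or.inr (Or.inr rfl)) hbc)
      · exact hl.boundary_iff (P := fun x => x = a ∨ x = c ∨ G.OpenTo ω x a ∨ G.OpenTo ω x c) ⟨fun _ => Or.inr (Or.inl rfl),
          fun _ => Or.inr (Or.inr (Or.inr ⟨e, hωe, hl⟩))⟩
  have hb := G.mem_of_conn_of_closed_boundary
    (X := {x | x = a ∨ x = c ∨ G.OpenTo ω x a ∨ G.OpenTo ω x c}) hX (Or.inl rfl) hconn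
  rcases hb with h' | h' | h' | h'
  · exact hab h'.symm
  · exact hbc h'
  · exact hbot.not_openTo_marks (Or.inr (Or.inl rfl)) (Or.inl rfl) hab.symm h'
  · exact hbot.not_openTo_marks (Or.inr (Or.inl rfl)) (Or.inr (Or.inr rfl)) hbc h'

/-- **Separation after opening edges away from `a`'s side** (Case 2): if `ω` is `bot` and every
edge open in `ω'` but closed in `ω` avoids `a` and the vertices with an open `ω`-edge to `a`, then
`a ≁ b` in `ω'`. -/
theorem IsBot.not_conn_ab_of_closed_side (hG : G.IsHubGraph a b c) (hs : G.IsSimple)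
    (hab : a ≠ b) (hac : a ≠ c) (hbc : b ≠ c) {ω ω' : Config E} (hbot : G.IsBot ω a b c)
    (hnew : ∀ e, ω' e = true → ω e = false →
      (G.fst e ≠ a ∧ ¬ G.OpenTo ω (G.fst e) a) ∧ (G.snd e ≠ a ∧ ¬ G.OpenTo ω (G.snd e) a)) :
    ¬ G.Conn ω' a b := by
  intro hconn
  have hX : ∀ e, ω' e = true →
      ((G.fst e = a ∨ G.OpenTo ω (G.fst e) a) ↔ (G.snd e = a ∨ G.OpenTo ω (G.snd e) a)) := by
    intro e he
    cases hωe : ω e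
    · obtain ⟨⟨h1, h2⟩, ⟨h3, h4⟩⟩ := hnew e he hωe
      constructor
      · rintro (h | h)
        · exact absurd h h1
        · exact absurd h h2
      · rintro (h | h)
        · exact absurd h h3
        · exact absurd h h4
    · rcases hG.edge_cases hs e with hl | hl | hl | ⟨h, hh, hl | hl | hl⟩
      · exact absurd ⟨e, hωe, hl⟩ (hbot.not_openTo_marks (Or.inl rfl) (Or.inr (Or.inl rfl)) hab)
      · exact absurd ⟨e, hωe, hl⟩ (hbot.not_openTo_marks (Or.inl rfl) (Or.inr (Or.inr rfl)) hac)
      · exact absurd ⟨e, hωe, hl⟩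
          (hbot.not_openTo_marks (Or.inr (Or.inl rfl)) (Or.inr (Or.inr rfl)) hbc)
      · exact hl.boundary_iff (P := fun x => x = a ∨ G.OpenTo ω x a) ⟨fun _ => Or.inl rfl, fun _ => Or.inr ⟨e, hωe, hl⟩⟩
      · refine hl.boundary_iff (P := fun x => x = a ∨ G.OpenTo ω x a) ?_
        constructor
        · rintro (h' | h')
          · exact absurd h' hh.1
          · exact (hbot.openTo_unique (Or.inl rfl) (Or.inr (Or.inl rfl)) hab h' ⟨e, hωe, hl⟩).elim
        · rintro (h' | h')
          · exact absurd h'.symm hab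
          · exact absurd h' (hbot.not_openTo_marks (Or.inr (Or.inl rfl)) (Or.inl rfl) hab.symm)
      · refine hl.boundary_iff (P := fun x => x = a ∨ G.OpenTo ω x a) ?_
        constructor
        · rintro (h' | h')
          · exact absurd h' hh.1
          · exact (hbot.openTo_unique (Or.inl rfl) (Or.inr (Or.inr rfl)) hac h' ⟨e, hωe, hl⟩).elim
        · rintro (h' | h')
          · exact absurd h'.symm hac
          · exact absurd h' (hbot.not_openTo_marks (Or.inr (Or.inr rfl)) (Or.inl rfl) hac.symm)
  have hb := G.mem_of_conn_of_closed_boundary (X := {x | x = a ∨ G.OpenTo ω x a}) hX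
    (Or.inl rfl) hconn
  rcases hb with h | h
  · exact hab h.symm
  · exact hbot.not_openTo_marks (Or.inr (Or.inl rfl)) (Or.inl rfl) hab.symm h

end Injection

end MultiGraph

end PercRepro
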